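import Summits.QuantumFields.BalabanUV.Beta.D1BFx.ChartDefectHead
import Summits.QuantumFields.BalabanUV.Beta.CombOneShotJetsTabs

/-!
# `BalabanUV.Beta.D1BFx.ChartDefectHeadScales` — road «BF-x», binder row D1, PART 24-hyb HEAD SKELETON ON THE SCALES (an2 R-D1-g48 W-6 (3): «state both
# uniformities EXPLICITLY»): **THE (J1) ROW `hC₁` OF `RoadEndBFxHybS.d1Rep_BFx_hyb_sbpS` AS EIGHT PRICED ROWS WITH m-INDEPENDENT CONSTANTS.**  At every scale
# `n = Lc^m` (`Lc` odd) the literal of record `JcOfTabs hLc N (k ↦ symTablesAn1S2 3 (Lc^k) (cΛ k)) cΛ (k ↦ −(Lc^k)¹²∕4)` (an1's tables, lockB) and the road's word at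
# `G₀ = coDressKBmAt (toSite (ctrOff 4 (Lc^m))) (Lc^m) K₀`: if the eight row kernels `W• m` (PINNED per scale to the eight groups of
# `ChartDefectTwoPins.chartDefect_record_eq_words` at `n := Lc^m`) have absolutely summable (1.22) second moments and bounds `|secondMoment (W• m) μ ν| ≤ C•` with
# constants `C•` FIXED BEFORE `∀ m` (m-UNIFORM by binder order — the first of the two uniformities), then for EVERY `m`
# `|secondMoment (a e z ↦ TshotOf Lc Jc m a e z − hessKer G₀ (vertexOfK G₀ (Lc^m) S⁰) (vertex2OfK G₀ (Lc^m) S₂⁰) a e z) μ ν| ≤ Σ C•` — `hC₁`'s binder VERBATIM after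
# `JcOfTabs_apply` ∕ `hrpin` ∕ `hSpin` (`ChartDefectWordsLiteral.RJ1_JcOfTabs_eq_words`' left side), with `CJ1 := Σ C•`.  THE SECOND UNIFORMITY (the torus size `p` of
# R-D1-g45-4 (3)(b)) DOES NOT ENTER THIS STATEMENT: the (1.22) moment of the tree is the infinite-volume lattice sum `∑' x : ℤ⁴` (`B12Beta.secondMoment`), no torus —
# `p` is the regulator of Engine C's float evaluation only; a row priced in THIS currency is tail-free in `p` by construction.  STANDING CONDITION (R-D1-g48 W-6 (3),
# carried, not discharged): a row found individually divergent along `m` is RE-PAIRED with its partner into one displayed row before pricing (theorem shape unchanged).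

HONEST DEPENDENCY (cell records, verbatim): «continuum YM on T⁴ ⇐ BetaPertH ∧ nine spine estimates (0/9 proved); BetaPertH ⇐ (D1) ∧ (D4) ∧
CAP+tail; G-an2-4 gates asym, D1 and NE2/3/4.»  HONEST FRAMING (cell contract, verbatim): «discharging `BetaPertH` makes Bałaban's UV stability
UNCONDITIONAL — a real constructive-QFT result; it is NOT the continuum limit and NOT the Clay problem.»  THIS MODULE DISCHARGES NO binder of row D1 and
NO estimate of Bałaban's: [folklore] bookkeeping (`JcOfTabs_apply` + the one-blocking skeleton at `n := Lc^m`); the eight rows are HYPOTHESES (displayed,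
none proved here); colour data HYPOTHESES; no definition, no `def … : Prop`, nothing cited, 0 sorry; one `set_option maxHeartbeats 400000 in` (statement elaboration of the scale-instantiated row
kernels only).  0∕4 row-D1 binders; (K) NOT closed; (J1) ONE OPEN ROW `hC₁` — cut into eight displayed m-uniform rows, none priced; NOT D1, NEVER «G-an2-4 closed», NOT `BetaPertH`, NOT continuum, NOT Clay.

ABSOLUTE RULE (cell charter, verbatim): «No internally-minted statement may enter as a cited fact. Every hypothesis is either kernel-proved in this
package or a verbatim quotation of a PUBLISHED theorem with page reference. The manuscript(s) under audit are NOT citable for their own disputed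
steps — they are the thing under adjudication; programme-internal (2001/route/tribunal) claims are never citable.»

Unit `b2b-balaban-beta-d1-p2` (road owner, gen 25), 2026-08-23; no existing file touched.
-/

noncomputable section

namespace Summit.QuantumFields.BalabanUV.Beta.D1BFx.ChartDefectHeadScales

open Finset
open scoped BigOperators
open Literature.MathematicalPhysics.QuantumFieldTheory
open Literature.MathematicalPhysics.QuantumFieldTheory.Balaban1983to89
open Literature.MathematicalPhysics.QuantumFieldTheory.Balaban1983to89.Beta
open Literature.MathematicalPhysics.QuantumFieldTheory.Balaban1983to89.B12Beta (secondMoment)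
open Literature.MathematicalPhysics.QuantumFieldTheory.Balaban1983to89.Beta.DecimatedMomentSummable (AbsMoment₂)
open ColourTrace (Complete TrOrthonormal)
open WilsonVertex2Sym (wsym22)
open WilsonBiStencil (wilsonW₂)
open StepJetData (wilsonA)
open ExpKernelCalculus (MKer comp tr tadpole bubble hessKer)
open OneStepResolventKernel (Fib TOf)
open OneStepKernelFamily (colH vertexOfK KInvStep TshotOf)
open SecondOrderResponse (vertexOfM mixOfK W2SymOfK vertex2OfK)
open BalabanStepW2 (M2Of)
open AffineAveraging (Site toSite)
open AveragingContours (blk)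
open AveragingContoursRooted (ctr ctrOff)
open Summit.QuantumFields.BalabanUV.Beta.BorderedHessian (diagK)
open Summit.QuantumFields.BalabanUV.Beta.DshAn1 (Dsh)
open Summit.QuantumFields.BalabanUV.Beta.AxialDressingRooted (coDressKBmAt)
open Summit.QuantumFields.BalabanUV.Beta.AxialProjectorBlockMean (bmGaugeAt)
open Summit.QuantumFields.BalabanUV.Beta.AveragingWardRootedStencils (legSite)
open Summit.QuantumFields.BalabanUV.Beta.SymAveragingHessianCounts (symVhSAt symHessFFAt)
open Summit.QuantumFields.BalabanUV.Beta.SymSecondOrderTablesAn1 (symVh₂SAn1 symTablesAn1S2)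
open Summit.QuantumFields.BalabanUV.Beta.CombChartStepJets (GcombSh JsB12CombSh0)
open Summit.QuantumFields.BalabanUV.Beta.CombChartJointEnd (JsB12CombShSym)
open Summit.QuantumFields.BalabanUV.Beta.CombOneShotJetsTabs (JcOfTabs JcOfTabs_apply)
open Summit.QuantumFields.BalabanUV.Beta.CompositeCorrectorLocality (blockSitesF)
open Summit.QuantumFields.BalabanUV.Beta.SymCorrectorFace (faceWt)
open Summit.QuantumFields.BalabanUV.Beta.D1BFx.ChartDefectHead (abs_secondMoment_chartDefect_le_of_rows)

variable {Lc : ℕ} [NeZero Lc] {N : ℕ} {C : Type*} [Fintype C] [DecidableEq C] {τ : C → Matrix (Fin N) (Fin N) ℂ}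

set_option maxHeartbeats 400000 in
/-- **THE (J1) ROW ON THE SCALES AS EIGHT PRICED ROWS, CONSTANTS m-INDEPENDENT** [folklore bookkeeping over one our-object identity per scale].
For `Lc` odd, the literal of record `Jc := JcOfTabs hLc N (k ↦ symTablesAn1S2 3 (Lc^k) (cΛ k)) cΛ (k ↦ −(Lc^k)¹²∕4)` and, per scale `m`, eight kernels `W• m` PINNED
(displayed equations `hW•`) to the eight groups of the (H3-Δ) word list at `n := Lc^m`: absolutely summable second moments (`hA•`) and bounds `hB• : ∀ m, |secondMoment (W• m) μ ν| ≤ C•`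
with the constants `C•` quantified BEFORE `m` ⟹ for every `m`,
`|secondMoment (a e z ↦ TshotOf Lc Jc m a e z − hessKer G₀ (vertexOfK G₀ (Lc^m) S⁰) (vertex2OfK G₀ (Lc^m) S₂⁰) a e z) μ ν| ≤ Cins + Crest + Cmcol + Cms + Clamf + Cdd + Cxb + Cbb`
(`G₀ := coDressKBmAt (toSite (ctrOff 4 (Lc^m))) (Lc^m) (KInvStep (Lc^m) 0)` — `RoadEndBFxHybS.d1Rep_BFx_hyb_sbpS`'s `hC₁` binder after `hrpin` ∕ `hSpin` ∕ `JcOfTabs_apply`, `CJ1 := Σ C•`).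
No row is priced here; the torus size of R-D1-g45-4 (3)(b) does not occur (the moment is the `ℤ⁴` sum).  (`maxHeartbeats 400000`: statement elaboration only —
the scale `Lc ^ m` is written out ≈ 200 times in the eight pinned row kernels; the proof is the one-blocking skeleton + `JcOfTabs_apply`.) -/
theorem abs_secondMoment_chartDefect_scales_le_of_rows (hLc : Odd Lc) (hτ : Complete τ) (ho : TrOrthonormal τ) (hN : N ≠ 0) (c : C) (cΛ : ℕ → ℝ)
    (μ ν : Fin 4)
    (Wins Wrest Wmcol Wms Wlamf Wdd Wxb Wbb : ℕ → Fin 4 → Fin 4 → Site 4 → ℝ)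
    -- (ins) the three `Dsh`-INSERTION words (`ColumnGaugeTwoPins.hessKer_GcombSh_sub_hessKer_G0bm` at `V := V^s`, `W := W_L`), at the scale `n := Lc^m`
    (hWins : ∀ (m : ℕ) (μ₀ ν₀ : Fin 4) (z₀ : Site 4), Wins m μ₀ ν₀ z₀
      = (-((1 / 2) * tr (comp (comp (comp (coDressKBmAt (ctr 4 (Lc ^ m)) (Lc ^ m) (KInvStep (d := 3) (Lc ^ m) 0)) (Dsh (Lc ^ m))) (GcombSh (d := 3) (Lc ^ m) 0)) (W2SymOfK (KInvStep (d := 3) (Lc ^ m) 0) (Lc ^ m) (fun κ u => (((Lc ^ m : ℕ) : ℝ) ^ 4) • wilsonA 3 κ u + (-(((Lc ^ m : ℕ) : ℝ) ^ 8 / 2)) • symVhSAt (ctr 4 (Lc ^ m)) 3 (Lc ^ m) rfl κ u)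
              ((symTablesAn1S2 3 (Lc ^ m) (cΛ m)).M 0) (fun κ u κ' u' => (((Lc ^ m : ℕ) : ℝ) ^ 8) • wilsonW₂ 3 ((8 * (N : ℝ) ^ 2)⁻¹ • wsym22 N) κ u κ' u' + (-(((Lc ^ m : ℕ) : ℝ) ^ 12 / 4)) • symVh₂SAn1 3 (Lc ^ m) κ u κ' u')
              (M2Of 3 (Lc ^ m) (symTablesAn1S2 3 (Lc ^ m) (cΛ m)).mixFF 0) μ₀ 0 ν₀ z₀
          + ((((comp (diagK fun z' b => ((Lc ^ m : ℕ) : ℝ) ^ 4 / 2 * bmGaugeAt (ctr 4 (Lc ^ m)) (colH (KInvStep (d := 3) (Lc ^ m) 0) (Lc ^ m) ν₀ z₀) (Lc ^ m) (legSite (ctr 4 (Lc ^ m)) z' b)) (vertexOfK (KInvStep (d := 3) (Lc ^ m) 0) (Lc ^ m) (fun κ u => (((Lc ^ m : ℕ) : ℝ) ^ 4) • wilsonA 3 κ u + (-(((Lc ^ m : ℕ) : ℝ) ^ 8 / 2)) • symVhSAt (ctr 4 (Lc ^ m)) 3 (Lc ^ m) rfl κ u) μ₀ 0)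
                - comp (vertexOfK (KInvStep (d := 3) (Lc ^ m) 0) (Lc ^ m) (fun κ u => (((Lc ^ m : ℕ) : ℝ) ^ 4) • wilsonA 3 κ u + (-(((Lc ^ m : ℕ) : ℝ) ^ 8 / 2)) • symVhSAt (ctr 4 (Lc ^ m)) 3 (Lc ^ m) rfl κ u) μ₀ 0) (diagK fun z' b => ((Lc ^ m : ℕ) : ℝ) ^ 4 / 2 * bmGaugeAt (ctr 4 (Lc ^ m)) (colH (KInvStep (d := 3) (Lc ^ m) 0) (Lc ^ m) ν₀ z₀) (Lc ^ m) (legSite (ctr 4 (Lc ^ m)) z' b)))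
              + (comp (diagK fun z' b => ((Lc ^ m : ℕ) : ℝ) ^ 4 / 2 * bmGaugeAt (ctr 4 (Lc ^ m)) (colH (KInvStep (d := 3) (Lc ^ m) 0) (Lc ^ m) μ₀ 0) (Lc ^ m) (legSite (ctr 4 (Lc ^ m)) z' b)) (vertexOfK (KInvStep (d := 3) (Lc ^ m) 0) (Lc ^ m) (fun κ u => (((Lc ^ m : ℕ) : ℝ) ^ 4) • wilsonA 3 κ u + (-(((Lc ^ m : ℕ) : ℝ) ^ 8 / 2)) • symVhSAt (ctr 4 (Lc ^ m)) 3 (Lc ^ m) rfl κ u) ν₀ z₀)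
                - comp (vertexOfK (KInvStep (d := 3) (Lc ^ m) 0) (Lc ^ m) (fun κ u => (((Lc ^ m : ℕ) : ℝ) ^ 4) • wilsonA 3 κ u + (-(((Lc ^ m : ℕ) : ℝ) ^ 8 / 2)) • symVhSAt (ctr 4 (Lc ^ m)) 3 (Lc ^ m) rfl κ u) ν₀ z₀) (diagK fun z' b => ((Lc ^ m : ℕ) : ℝ) ^ 4 / 2 * bmGaugeAt (ctr 4 (Lc ^ m)) (colH (KInvStep (d := 3) (Lc ^ m) 0) (Lc ^ m) μ₀ 0) (Lc ^ m) (legSite (ctr 4 (Lc ^ m)) z' b)))))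
            - (((comp (diagK fun z' b => ((Lc ^ m : ℕ) : ℝ) ^ 4 / 2 * bmGaugeAt (ctr 4 (Lc ^ m)) (colH (KInvStep (d := 3) (Lc ^ m) 0) (Lc ^ m) ν₀ z₀) (Lc ^ m) (legSite (ctr 4 (Lc ^ m)) z' b)) (vertexOfK (KInvStep (d := 3) (Lc ^ m) 0) (Lc ^ m) (JsB12CombSh0 (Lc := Lc ^ m) hLc.pow N (symTablesAn1S2 3 (Lc ^ m) (cΛ m)) (cΛ m) (-(((Lc ^ m : ℕ) : ℝ) ^ 12 / 4)) 0).S μ₀ 0)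
                - comp (vertexOfK (KInvStep (d := 3) (Lc ^ m) 0) (Lc ^ m) (JsB12CombSh0 (Lc := Lc ^ m) hLc.pow N (symTablesAn1S2 3 (Lc ^ m) (cΛ m)) (cΛ m) (-(((Lc ^ m : ℕ) : ℝ) ^ 12 / 4)) 0).S μ₀ 0) (diagK fun z' b => ((Lc ^ m : ℕ) : ℝ) ^ 4 / 2 * bmGaugeAt (ctr 4 (Lc ^ m)) (colH (KInvStep (d := 3) (Lc ^ m) 0) (Lc ^ m) ν₀ z₀) (Lc ^ m) (legSite (ctr 4 (Lc ^ m)) z' b)))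
              + (comp (diagK fun z' b => ((Lc ^ m : ℕ) : ℝ) ^ 4 / 2 * bmGaugeAt (ctr 4 (Lc ^ m)) (colH (KInvStep (d := 3) (Lc ^ m) 0) (Lc ^ m) μ₀ 0) (Lc ^ m) (legSite (ctr 4 (Lc ^ m)) z' b)) (vertexOfK (KInvStep (d := 3) (Lc ^ m) 0) (Lc ^ m) (JsB12CombSh0 (Lc := Lc ^ m) hLc.pow N (symTablesAn1S2 3 (Lc ^ m) (cΛ m)) (cΛ m) (-(((Lc ^ m : ℕ) : ℝ) ^ 12 / 4)) 0).S ν₀ z₀)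
                - comp (vertexOfK (KInvStep (d := 3) (Lc ^ m) 0) (Lc ^ m) (JsB12CombSh0 (Lc := Lc ^ m) hLc.pow N (symTablesAn1S2 3 (Lc ^ m) (cΛ m)) (cΛ m) (-(((Lc ^ m : ℕ) : ℝ) ^ 12 / 4)) 0).S ν₀ z₀) (diagK fun z' b => ((Lc ^ m : ℕ) : ℝ) ^ 4 / 2 * bmGaugeAt (ctr 4 (Lc ^ m)) (colH (KInvStep (d := 3) (Lc ^ m) 0) (Lc ^ m) μ₀ 0) (Lc ^ m) (legSite (ctr 4 (Lc ^ m)) z' b))))))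
          + ((mixOfK (coDressKBmAt (ctr 4 (Lc ^ m)) (Lc ^ m) (KInvStep (d := 3) (Lc ^ m) 0)) (Lc ^ m) (M2Of 3 (Lc ^ m) (symTablesAn1S2 3 (Lc ^ m) (cΛ m)).mixFF 0) μ₀ 0 ν₀ z₀
                - mixOfK (KInvStep (d := 3) (Lc ^ m) 0) (Lc ^ m) (M2Of 3 (Lc ^ m) (symTablesAn1S2 3 (Lc ^ m) (cΛ m)).mixFF 0) μ₀ 0 ν₀ z₀)
            + (mixOfK (coDressKBmAt (ctr 4 (Lc ^ m)) (Lc ^ m) (KInvStep (d := 3) (Lc ^ m) 0)) (Lc ^ m) (M2Of 3 (Lc ^ m) (symTablesAn1S2 3 (Lc ^ m) (cΛ m)).mixFF 0) ν₀ z₀ μ₀ 0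
                - mixOfK (KInvStep (d := 3) (Lc ^ m) 0) (Lc ^ m) (M2Of 3 (Lc ^ m) (symTablesAn1S2 3 (Lc ^ m) (cΛ m)).mixFF 0) ν₀ z₀ μ₀ 0))
          + (((mixOfK (coDressKBmAt (ctr 4 (Lc ^ m)) (Lc ^ m) (KInvStep (d := 3) (Lc ^ m) 0)) (Lc ^ m) (fun κ u ρ w => (if blk (Lc ^ m) (((Lc ^ m : ℕ) : ℤ) • w + (ctr 4 (Lc ^ m))) = blk (Lc ^ m) u then 2 * faceWt (ctrOff 4 (Lc ^ m)) (Lc ^ m) κ u else 0) • (symHessFFAt (ctr 4 (Lc ^ m)) (Lc ^ m)) ρ w) μ₀ 0 ν₀ z₀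
                + mixOfK (coDressKBmAt (ctr 4 (Lc ^ m)) (Lc ^ m) (KInvStep (d := 3) (Lc ^ m) 0)) (Lc ^ m) (fun κ u ρ w => (if blk (Lc ^ m) (((Lc ^ m : ℕ) : ℤ) • w + (ctr 4 (Lc ^ m))) = blk (Lc ^ m) u then 2 * faceWt (ctrOff 4 (Lc ^ m)) (Lc ^ m) κ u else 0) • (symHessFFAt (ctr 4 (Lc ^ m)) (Lc ^ m)) ρ w) ν₀ z₀ μ₀ 0)
              - (comp (diagK fun z b => ∑ α : Fin (3 + 1), ∑ x ∈ blockSitesF (Lc ^ m) (blk (Lc ^ m) (legSite (ctr 4 (Lc ^ m)) z b)), colH (coDressKBmAt (ctr 4 (Lc ^ m)) (Lc ^ m) (KInvStep (d := 3) (Lc ^ m) 0)) (Lc ^ m) μ₀ 0 α x * (2 * faceWt (ctrOff 4 (Lc ^ m)) (Lc ^ m) α x)) (vertexOfM (coDressKBmAt (ctr 4 (Lc ^ m)) (Lc ^ m) (KInvStep (d := 3) (Lc ^ m) 0)) (Lc ^ m) (symHessFFAt (ctr 4 (Lc ^ m)) (Lc ^ m)) ν₀ z₀)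
                + comp (diagK fun z b => ∑ α : Fin (3 + 1), ∑ x ∈ blockSitesF (Lc ^ m) (blk (Lc ^ m) (legSite (ctr 4 (Lc ^ m)) z b)), colH (coDressKBmAt (ctr 4 (Lc ^ m)) (Lc ^ m) (KInvStep (d := 3) (Lc ^ m) 0)) (Lc ^ m) ν₀ z₀ α x * (2 * faceWt (ctrOff 4 (Lc ^ m)) (Lc ^ m) α x)) (vertexOfM (coDressKBmAt (ctr 4 (Lc ^ m)) (Lc ^ m) (KInvStep (d := 3) (Lc ^ m) 0)) (Lc ^ m) (symHessFFAt (ctr 4 (Lc ^ m)) (Lc ^ m)) μ₀ 0)))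
          + ((((comp (diagK fun z b => -(∑ α : Fin (3 + 1), ∑ x ∈ blockSitesF (Lc ^ m) (blk (Lc ^ m) (legSite (ctr 4 (Lc ^ m)) z b)), colH (coDressKBmAt (ctr 4 (Lc ^ m)) (Lc ^ m) (KInvStep (d := 3) (Lc ^ m) 0)) (Lc ^ m) ν₀ z₀ α x * ((((Lc ^ m : ℕ) : ℝ) ^ 4 / 2) * faceWt (ctrOff 4 (Lc ^ m)) (Lc ^ m) α x))) (vertexOfK (coDressKBmAt (ctr 4 (Lc ^ m)) (Lc ^ m) (KInvStep (d := 3) (Lc ^ m) 0)) (Lc ^ m) (fun κ u => (((Lc ^ m : ℕ) : ℝ) ^ 4) • wilsonA 3 κ u + (-(((Lc ^ m : ℕ) : ℝ) ^ 8 / 2)) • symVhSAt (ctr 4 (Lc ^ m)) 3 (Lc ^ m) rfl κ u) μ₀ 0)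
                - comp (vertexOfK (coDressKBmAt (ctr 4 (Lc ^ m)) (Lc ^ m) (KInvStep (d := 3) (Lc ^ m) 0)) (Lc ^ m) (fun κ u => (((Lc ^ m : ℕ) : ℝ) ^ 4) • wilsonA 3 κ u + (-(((Lc ^ m : ℕ) : ℝ) ^ 8 / 2)) • symVhSAt (ctr 4 (Lc ^ m)) 3 (Lc ^ m) rfl κ u) μ₀ 0) (diagK fun z b => -(∑ α : Fin (3 + 1), ∑ x ∈ blockSitesF (Lc ^ m) (blk (Lc ^ m) (legSite (ctr 4 (Lc ^ m)) z b)), colH (coDressKBmAt (ctr 4 (Lc ^ m)) (Lc ^ m) (KInvStep (d := 3) (Lc ^ m) 0)) (Lc ^ m) ν₀ z₀ α x * ((((Lc ^ m : ℕ) : ℝ) ^ 4 / 2) * faceWt (ctrOff 4 (Lc ^ m)) (Lc ^ m) α x))))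
              + (comp (diagK fun z b => -(∑ α : Fin (3 + 1), ∑ x ∈ blockSitesF (Lc ^ m) (blk (Lc ^ m) (legSite (ctr 4 (Lc ^ m)) z b)), colH (coDressKBmAt (ctr 4 (Lc ^ m)) (Lc ^ m) (KInvStep (d := 3) (Lc ^ m) 0)) (Lc ^ m) μ₀ 0 α x * ((((Lc ^ m : ℕ) : ℝ) ^ 4 / 2) * faceWt (ctrOff 4 (Lc ^ m)) (Lc ^ m) α x))) (vertexOfK (coDressKBmAt (ctr 4 (Lc ^ m)) (Lc ^ m) (KInvStep (d := 3) (Lc ^ m) 0)) (Lc ^ m) (fun κ u => (((Lc ^ m : ℕ) : ℝ) ^ 4) • wilsonA 3 κ u + (-(((Lc ^ m : ℕ) : ℝ) ^ 8 / 2)) • symVhSAt (ctr 4 (Lc ^ m)) 3 (Lc ^ m) rfl κ u) ν₀ z₀)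
                - comp (vertexOfK (coDressKBmAt (ctr 4 (Lc ^ m)) (Lc ^ m) (KInvStep (d := 3) (Lc ^ m) 0)) (Lc ^ m) (fun κ u => (((Lc ^ m : ℕ) : ℝ) ^ 4) • wilsonA 3 κ u + (-(((Lc ^ m : ℕ) : ℝ) ^ 8 / 2)) • symVhSAt (ctr 4 (Lc ^ m)) 3 (Lc ^ m) rfl κ u) ν₀ z₀) (diagK fun z b => -(∑ α : Fin (3 + 1), ∑ x ∈ blockSitesF (Lc ^ m) (blk (Lc ^ m) (legSite (ctr 4 (Lc ^ m)) z b)), colH (coDressKBmAt (ctr 4 (Lc ^ m)) (Lc ^ m) (KInvStep (d := 3) (Lc ^ m) 0)) (Lc ^ m) μ₀ 0 α x * ((((Lc ^ m : ℕ) : ℝ) ^ 4 / 2) * faceWt (ctrOff 4 (Lc ^ m)) (Lc ^ m) α x))))))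
            - (((comp (diagK fun z b => -(∑ α : Fin (3 + 1), ∑ x ∈ blockSitesF (Lc ^ m) (blk (Lc ^ m) (legSite (ctr 4 (Lc ^ m)) z b)), colH (coDressKBmAt (ctr 4 (Lc ^ m)) (Lc ^ m) (KInvStep (d := 3) (Lc ^ m) 0)) (Lc ^ m) ν₀ z₀ α x * ((((Lc ^ m : ℕ) : ℝ) ^ 4 / 2) * faceWt (ctrOff 4 (Lc ^ m)) (Lc ^ m) α x))) (vertexOfK (coDressKBmAt (ctr 4 (Lc ^ m)) (Lc ^ m) (KInvStep (d := 3) (Lc ^ m) 0)) (Lc ^ m) (JsB12CombSh0 (Lc := Lc ^ m) hLc.pow N (symTablesAn1S2 3 (Lc ^ m) (cΛ m)) (cΛ m) (-(((Lc ^ m : ℕ) : ℝ) ^ 12 / 4)) 0).S μ₀ 0)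
                - comp (vertexOfK (coDressKBmAt (ctr 4 (Lc ^ m)) (Lc ^ m) (KInvStep (d := 3) (Lc ^ m) 0)) (Lc ^ m) (JsB12CombSh0 (Lc := Lc ^ m) hLc.pow N (symTablesAn1S2 3 (Lc ^ m) (cΛ m)) (cΛ m) (-(((Lc ^ m : ℕ) : ℝ) ^ 12 / 4)) 0).S μ₀ 0) (diagK fun z b => -(∑ α : Fin (3 + 1), ∑ x ∈ blockSitesF (Lc ^ m) (blk (Lc ^ m) (legSite (ctr 4 (Lc ^ m)) z b)), colH (coDressKBmAt (ctr 4 (Lc ^ m)) (Lc ^ m) (KInvStep (d := 3) (Lc ^ m) 0)) (Lc ^ m) ν₀ z₀ α x * ((((Lc ^ m : ℕ) : ℝ) ^ 4 / 2) * faceWt (ctrOff 4 (Lc ^ m)) (Lc ^ m) α x))))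
              + (comp (diagK fun z b => -(∑ α : Fin (3 + 1), ∑ x ∈ blockSitesF (Lc ^ m) (blk (Lc ^ m) (legSite (ctr 4 (Lc ^ m)) z b)), colH (coDressKBmAt (ctr 4 (Lc ^ m)) (Lc ^ m) (KInvStep (d := 3) (Lc ^ m) 0)) (Lc ^ m) μ₀ 0 α x * ((((Lc ^ m : ℕ) : ℝ) ^ 4 / 2) * faceWt (ctrOff 4 (Lc ^ m)) (Lc ^ m) α x))) (vertexOfK (coDressKBmAt (ctr 4 (Lc ^ m)) (Lc ^ m) (KInvStep (d := 3) (Lc ^ m) 0)) (Lc ^ m) (JsB12CombSh0 (Lc := Lc ^ m) hLc.pow N (symTablesAn1S2 3 (Lc ^ m) (cΛ m)) (cΛ m) (-(((Lc ^ m : ℕ) : ℝ) ^ 12 / 4)) 0).S ν₀ z₀)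
                - comp (vertexOfK (coDressKBmAt (ctr 4 (Lc ^ m)) (Lc ^ m) (KInvStep (d := 3) (Lc ^ m) 0)) (Lc ^ m) (JsB12CombSh0 (Lc := Lc ^ m) hLc.pow N (symTablesAn1S2 3 (Lc ^ m) (cΛ m)) (cΛ m) (-(((Lc ^ m : ℕ) : ℝ) ^ 12 / 4)) 0).S ν₀ z₀) (diagK fun z b => -(∑ α : Fin (3 + 1), ∑ x ∈ blockSitesF (Lc ^ m) (blk (Lc ^ m) (legSite (ctr 4 (Lc ^ m)) z b)), colH (coDressKBmAt (ctr 4 (Lc ^ m)) (Lc ^ m) (KInvStep (d := 3) (Lc ^ m) 0)) (Lc ^ m) μ₀ 0 α x * ((((Lc ^ m : ℕ) : ℝ) ^ 4 / 2) * faceWt (ctrOff 4 (Lc ^ m)) (Lc ^ m) α x)))))))))))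
        + (1 / 2) * (tr (comp (comp (comp (comp (coDressKBmAt (ctr 4 (Lc ^ m)) (Lc ^ m) (KInvStep (d := 3) (Lc ^ m) 0)) (Dsh (Lc ^ m))) (GcombSh (d := 3) (Lc ^ m) 0)) (vertexOfK (KInvStep (d := 3) (Lc ^ m) 0) (Lc ^ m) (JsB12CombSh0 (Lc := Lc ^ m) hLc.pow N (symTablesAn1S2 3 (Lc ^ m) (cΛ m)) (cΛ m) (-(((Lc ^ m : ℕ) : ℝ) ^ 12 / 4)) 0).S μ₀ 0)) (comp (GcombSh (d := 3) (Lc ^ m) 0) (vertexOfK (KInvStep (d := 3) (Lc ^ m) 0) (Lc ^ m) (JsB12CombSh0 (Lc := Lc ^ m) hLc.pow N (symTablesAn1S2 3 (Lc ^ m) (cΛ m)) (cΛ m) (-(((Lc ^ m : ℕ) : ℝ) ^ 12 / 4)) 0).S ν₀ z₀)))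
          + tr (comp (comp (coDressKBmAt (ctr 4 (Lc ^ m)) (Lc ^ m) (KInvStep (d := 3) (Lc ^ m) 0)) (vertexOfK (KInvStep (d := 3) (Lc ^ m) 0) (Lc ^ m) (JsB12CombSh0 (Lc := Lc ^ m) hLc.pow N (symTablesAn1S2 3 (Lc ^ m) (cΛ m)) (cΛ m) (-(((Lc ^ m : ℕ) : ℝ) ^ 12 / 4)) 0).S μ₀ 0)) (comp (comp (comp (coDressKBmAt (ctr 4 (Lc ^ m)) (Lc ^ m) (KInvStep (d := 3) (Lc ^ m) 0)) (Dsh (Lc ^ m))) (GcombSh (d := 3) (Lc ^ m) 0)) (vertexOfK (KInvStep (d := 3) (Lc ^ m) 0) (Lc ^ m) (JsB12CombSh0 (Lc := Lc ^ m) hLc.pow N (symTablesAn1S2 3 (Lc ^ m) (cΛ m)) (cΛ m) (-(((Lc ^ m : ℕ) : ℝ) ^ 12 / 4)) 0).S ν₀ z₀))))))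
    -- (rest) `½·tadpole G₀` of the (D-R) rest (`= ½·tadpole G₀` of the straight mixed pair `mixOfK K₀ n M₂⁰ μ₀ 0 ν₀ z₀ + mixOfK K₀ n M₂⁰ ν₀ z₀ μ₀ 0`, `ChartDefectTwoPinsRest.tadpole_rest_record_eq`), at the scale `n := Lc^m`
    (hWrest : ∀ (m : ℕ) (μ₀ ν₀ : Fin 4) (z₀ : Site 4), Wrest m μ₀ ν₀ z₀
      = (1 / 2) * tadpole (coDressKBmAt (ctr 4 (Lc ^ m)) (Lc ^ m) (KInvStep (d := 3) (Lc ^ m) 0)) (W2SymOfK (KInvStep (d := 3) (Lc ^ m) 0) (Lc ^ m) (fun κ u => (((Lc ^ m : ℕ) : ℝ) ^ 4) • wilsonA 3 κ u + (-(((Lc ^ m : ℕ) : ℝ) ^ 8 / 2)) • symVhSAt (ctr 4 (Lc ^ m)) 3 (Lc ^ m) rfl κ u)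
              ((symTablesAn1S2 3 (Lc ^ m) (cΛ m)).M 0) (fun κ u κ' u' => (((Lc ^ m : ℕ) : ℝ) ^ 8) • wilsonW₂ 3 ((8 * (N : ℝ) ^ 2)⁻¹ • wsym22 N) κ u κ' u' + (-(((Lc ^ m : ℕ) : ℝ) ^ 12 / 4)) • symVh₂SAn1 3 (Lc ^ m) κ u κ' u')
              (M2Of 3 (Lc ^ m) (symTablesAn1S2 3 (Lc ^ m) (cΛ m)).mixFF 0) μ₀ 0 ν₀ z₀
            - vertex2OfK (KInvStep (d := 3) (Lc ^ m) 0) (Lc ^ m)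
              (fun κ u κ' u' => (((Lc ^ m : ℕ) : ℝ) ^ 8) • wilsonW₂ 3 ((8 * (N : ℝ) ^ 2)⁻¹ • wsym22 N) κ u κ' u' + (-(((Lc ^ m : ℕ) : ℝ) ^ 12 / 4)) • symVh₂SAn1 3 (Lc ^ m) κ u κ' u') μ₀ 0 ν₀ z₀))
    -- (mcol) `½·tadpole G₀ (W^{Mcol}_c μ₀ 0 ν₀ z₀)` (`= ½·tadpole G₀ ([Λ′ ν₀ z₀, V_H μ₀ 0] + [Λ′ μ₀ 0, V_H ν₀ z₀])`, `ChartDefectTwoPinsRest.tadpole_WMcol_record_eq`; letter: leaf-01's `vertexFamily₂_Wmix_of_weight` at `ξ := 1`), at the scale `n := Lc^m`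
    (hWmcol : ∀ (m : ℕ) (μ₀ ν₀ : Fin 4) (z₀ : Site 4), Wmcol m μ₀ ν₀ z₀
      = (1 / 2) * tadpole (coDressKBmAt (ctr 4 (Lc ^ m)) (Lc ^ m) (KInvStep (d := 3) (Lc ^ m) 0)) (((mixOfK (coDressKBmAt (ctr 4 (Lc ^ m)) (Lc ^ m) (KInvStep (d := 3) (Lc ^ m) 0)) (Lc ^ m) (M2Of 3 (Lc ^ m) (symTablesAn1S2 3 (Lc ^ m) (cΛ m)).mixFF 0) μ₀ 0 ν₀ z₀
                - mixOfK (KInvStep (d := 3) (Lc ^ m) 0) (Lc ^ m) (M2Of 3 (Lc ^ m) (symTablesAn1S2 3 (Lc ^ m) (cΛ m)).mixFF 0) μ₀ 0 ν₀ z₀)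
            + (mixOfK (coDressKBmAt (ctr 4 (Lc ^ m)) (Lc ^ m) (KInvStep (d := 3) (Lc ^ m) 0)) (Lc ^ m) (M2Of 3 (Lc ^ m) (symTablesAn1S2 3 (Lc ^ m) (cΛ m)).mixFF 0) ν₀ z₀ μ₀ 0
                - mixOfK (KInvStep (d := 3) (Lc ^ m) 0) (Lc ^ m) (M2Of 3 (Lc ^ m) (symTablesAn1S2 3 (Lc ^ m) (cΛ m)).mixFF 0) ν₀ z₀ μ₀ 0))))
    -- (ms) `½·tadpole G₀ (WMs[G₀] μ₀ 0 ν₀ z₀)` (`= ¼·tadpole G₀ (conjV (V_H ν₀ z₀) (Θ′ μ₀ 0) + conjV (V_H μ₀ 0) (Θ′ ν₀ z₀))`, `ChartDefectTwoPinsRest.tadpole_WMs_record_eq`), at the scale `n := Lc^m`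
    (hWms : ∀ (m : ℕ) (μ₀ ν₀ : Fin 4) (z₀ : Site 4), Wms m μ₀ ν₀ z₀
      = (1 / 2) * tadpole (coDressKBmAt (ctr 4 (Lc ^ m)) (Lc ^ m) (KInvStep (d := 3) (Lc ^ m) 0)) (((mixOfK (coDressKBmAt (ctr 4 (Lc ^ m)) (Lc ^ m) (KInvStep (d := 3) (Lc ^ m) 0)) (Lc ^ m) (fun κ u ρ w => (if blk (Lc ^ m) (((Lc ^ m : ℕ) : ℤ) • w + (ctr 4 (Lc ^ m))) = blk (Lc ^ m) u then 2 * faceWt (ctrOff 4 (Lc ^ m)) (Lc ^ m) κ u else 0) • (symHessFFAt (ctr 4 (Lc ^ m)) (Lc ^ m)) ρ w) μ₀ 0 ν₀ z₀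
                + mixOfK (coDressKBmAt (ctr 4 (Lc ^ m)) (Lc ^ m) (KInvStep (d := 3) (Lc ^ m) 0)) (Lc ^ m) (fun κ u ρ w => (if blk (Lc ^ m) (((Lc ^ m : ℕ) : ℤ) • w + (ctr 4 (Lc ^ m))) = blk (Lc ^ m) u then 2 * faceWt (ctrOff 4 (Lc ^ m)) (Lc ^ m) κ u else 0) • (symHessFFAt (ctr 4 (Lc ^ m)) (Lc ^ m)) ρ w) ν₀ z₀ μ₀ 0)
              - (comp (diagK fun z b => ∑ α : Fin (3 + 1), ∑ x ∈ blockSitesF (Lc ^ m) (blk (Lc ^ m) (legSite (ctr 4 (Lc ^ m)) z b)), colH (coDressKBmAt (ctr 4 (Lc ^ m)) (Lc ^ m) (KInvStep (d := 3) (Lc ^ m) 0)) (Lc ^ m) μ₀ 0 α x * (2 * faceWt (ctrOff 4 (Lc ^ m)) (Lc ^ m) α x)) (vertexOfM (coDressKBmAt (ctr 4 (Lc ^ m)) (Lc ^ m) (KInvStep (d := 3) (Lc ^ m) 0)) (Lc ^ m) (symHessFFAt (ctr 4 (Lc ^ m)) (Lc ^ m)) ν₀ z₀)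
                + comp (diagK fun z b => ∑ α : Fin (3 + 1), ∑ x ∈ blockSitesF (Lc ^ m) (blk (Lc ^ m) (legSite (ctr 4 (Lc ^ m)) z b)), colH (coDressKBmAt (ctr 4 (Lc ^ m)) (Lc ^ m) (KInvStep (d := 3) (Lc ^ m) 0)) (Lc ^ m) ν₀ z₀ α x * (2 * faceWt (ctrOff 4 (Lc ^ m)) (Lc ^ m) α x)) (vertexOfM (coDressKBmAt (ctr 4 (Lc ^ m)) (Lc ^ m) (KInvStep (d := 3) (Lc ^ m) 0)) (Lc ^ m) (symHessFFAt (ctr 4 (Lc ^ m)) (Lc ^ m)) μ₀ 0)))))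
    -- (lamf) `½·tadpole G₀ (W^{Λ}_f μ₀ 0 ν₀ z₀)` — the FACE Λ-sector word (face gauge generator `Λf[G₀]`, families `vertexOfK G₀ n S♭ ∕ S⁰`), at the scale `n := Lc^m`
    (hWlamf : ∀ (m : ℕ) (μ₀ ν₀ : Fin 4) (z₀ : Site 4), Wlamf m μ₀ ν₀ z₀
      = (1 / 2) * tadpole (coDressKBmAt (ctr 4 (Lc ^ m)) (Lc ^ m) (KInvStep (d := 3) (Lc ^ m) 0)) ((((comp (diagK fun z b => -(∑ α : Fin (3 + 1), ∑ x ∈ blockSitesF (Lc ^ m) (blk (Lc ^ m) (legSite (ctr 4 (Lc ^ m)) z b)), colH (coDressKBmAt (ctr 4 (Lc ^ m)) (Lc ^ m) (KInvStep (d := 3) (Lc ^ m) 0)) (Lc ^ m) ν₀ z₀ α x * ((((Lc ^ m : ℕ) : ℝ) ^ 4 / 2) * faceWt (ctrOff 4 (Lc ^ m)) (Lc ^ m) α x))) (vertexOfK (coDressKBmAt (ctr 4 (Lc ^ m)) (Lc ^ m) (KInvStep (d := 3) (Lc ^ m) 0)) (Lc ^ m) (fun κ u => (((Lc ^ m : ℕ)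 : ℝ) ^ 4) • wilsonA 3 κ u + (-(((Lc ^ m : ℕ) : ℝ) ^ 8 / 2)) • symVhSAt (ctr 4 (Lc ^ m)) 3 (Lc ^ m) rfl κ u) μ₀ 0)
                - comp (vertexOfK (coDressKBmAt (ctr 4 (Lc ^ m)) (Lc ^ m) (KInvStep (d := 3) (Lc ^ m) 0)) (Lc ^ m) (fun κ u => (((Lc ^ m : ℕ) : ℝ) ^ 4) • wilsonA 3 κ u + (-(((Lc ^ m : ℕ) : ℝ) ^ 8 / 2)) • symVhSAt (ctr 4 (Lc ^ m)) 3 (Lc ^ m) rfl κ u) μ₀ 0) (diagK fun z b => -(∑ α : Fin (3 + 1), ∑ x ∈ blockSitesF (Lc ^ m) (blk (Lc ^ m) (legSite (ctr 4 (Lc ^ m)) z b)), colH (coDressKBmAt (ctr 4 (Lc ^ m)) (Lc ^ m) (KInvStep (d := 3) (Lc ^ m) 0)) (Lc ^ m) ν₀ z₀ α x * ((((Lc ^ m : ℕ) : ℝ) ^ 4 / 2) * faceWt (ctrOff 4 (Lc ^ m)) (Lc ^ m) α x))))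
              + (comp (diagK fun z b => -(∑ α : Fin (3 + 1), ∑ x ∈ blockSitesF (Lc ^ m) (blk (Lc ^ m) (legSite (ctr 4 (Lc ^ m)) z b)), colH (coDressKBmAt (ctr 4 (Lc ^ m)) (Lc ^ m) (KInvStep (d := 3) (Lc ^ m) 0)) (Lc ^ m) μ₀ 0 α x * ((((Lc ^ m : ℕ) : ℝ) ^ 4 / 2) * faceWt (ctrOff 4 (Lc ^ m)) (Lc ^ m) α x))) (vertexOfK (coDressKBmAt (ctr 4 (Lc ^ m)) (Lc ^ m) (KInvStep (d := 3) (Lc ^ m) 0)) (Lc ^ m) (fun κ u => (((Lc ^ m : ℕ) : ℝ) ^ 4) • wilsonA 3 κ u + (-(((Lc ^ m : ℕ) : ℝ) ^ 8 / 2)) • symVhSAt (ctr 4 (Lc ^ m)) 3 (Lc ^ m) rfl κ u) ν₀ z₀)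
                - comp (vertexOfK (coDressKBmAt (ctr 4 (Lc ^ m)) (Lc ^ m) (KInvStep (d := 3) (Lc ^ m) 0)) (Lc ^ m) (fun κ u => (((Lc ^ m : ℕ) : ℝ) ^ 4) • wilsonA 3 κ u + (-(((Lc ^ m : ℕ) : ℝ) ^ 8 / 2)) • symVhSAt (ctr 4 (Lc ^ m)) 3 (Lc ^ m) rfl κ u) ν₀ z₀) (diagK fun z b => -(∑ α : Fin (3 + 1), ∑ x ∈ blockSitesF (Lc ^ m) (blk (Lc ^ m) (legSite (ctr 4 (Lc ^ m)) z b)), colH (coDressKBmAt (ctr 4 (Lc ^ m)) (Lc ^ m) (KInvStep (d := 3) (Lc ^ m) 0)) (Lc ^ m) μ₀ 0 α x * ((((Lc ^ m : ℕ) : ℝ) ^ 4 / 2) * faceWt (ctrOff 4 (Lc ^ m)) (Lc ^ m) α x))))))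
            - (((comp (diagK fun z b => -(∑ α : Fin (3 + 1), ∑ x ∈ blockSitesF (Lc ^ m) (blk (Lc ^ m) (legSite (ctr 4 (Lc ^ m)) z b)), colH (coDressKBmAt (ctr 4 (Lc ^ m)) (Lc ^ m) (KInvStep (d := 3) (Lc ^ m) 0)) (Lc ^ m) ν₀ z₀ α x * ((((Lc ^ m : ℕ) : ℝ) ^ 4 / 2) * faceWt (ctrOff 4 (Lc ^ m)) (Lc ^ m) α x))) (vertexOfK (coDressKBmAt (ctr 4 (Lc ^ m)) (Lc ^ m) (KInvStep (d := 3) (Lc ^ m) 0)) (Lc ^ m) (JsB12CombSh0 (Lc := Lc ^ m) hLc.pow N (symTablesAn1S2 3 (Lc ^ m) (cΛ m)) (cΛ m) (-(((Lc ^ m : ℕ) : ℝ) ^ 12 / 4)) 0).S μ₀ 0)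
                - comp (vertexOfK (coDressKBmAt (ctr 4 (Lc ^ m)) (Lc ^ m) (KInvStep (d := 3) (Lc ^ m) 0)) (Lc ^ m) (JsB12CombSh0 (Lc := Lc ^ m) hLc.pow N (symTablesAn1S2 3 (Lc ^ m) (cΛ m)) (cΛ m) (-(((Lc ^ m : ℕ) : ℝ) ^ 12 / 4)) 0).S μ₀ 0) (diagK fun z b => -(∑ α : Fin (3 + 1), ∑ x ∈ blockSitesF (Lc ^ m) (blk (Lc ^ m) (legSite (ctr 4 (Lc ^ m)) z b)), colH (coDressKBmAt (ctr 4 (Lc ^ m)) (Lc ^ m) (KInvStep (d := 3) (Lc ^ m) 0)) (Lc ^ m) ν₀ z₀ α x * ((((Lc ^ m : ℕ) : ℝ) ^ 4 / 2) * faceWt (ctrOff 4 (Lc ^ m)) (Lc ^ m) α x))))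
              + (comp (diagK fun z b => -(∑ α : Fin (3 + 1), ∑ x ∈ blockSitesF (Lc ^ m) (blk (Lc ^ m) (legSite (ctr 4 (Lc ^ m)) z b)), colH (coDressKBmAt (ctr 4 (Lc ^ m)) (Lc ^ m) (KInvStep (d := 3) (Lc ^ m) 0)) (Lc ^ m) μ₀ 0 α x * ((((Lc ^ m : ℕ) : ℝ) ^ 4 / 2) * faceWt (ctrOff 4 (Lc ^ m)) (Lc ^ m) α x))) (vertexOfK (coDressKBmAt (ctr 4 (Lc ^ m)) (Lc ^ m) (KInvStep (d := 3) (Lc ^ m) 0)) (Lc ^ m) (JsB12CombSh0 (Lc := Lc ^ m) hLc.pow N (symTablesAn1S2 3 (Lc ^ m) (cΛ m)) (cΛ m) (-(((Lc ^ m : ℕ) : ℝ) ^ 12 / 4)) 0).S ν₀ z₀)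
                - comp (vertexOfK (coDressKBmAt (ctr 4 (Lc ^ m)) (Lc ^ m) (KInvStep (d := 3) (Lc ^ m) 0)) (Lc ^ m) (JsB12CombSh0 (Lc := Lc ^ m) hLc.pow N (symTablesAn1S2 3 (Lc ^ m) (cΛ m)) (cΛ m) (-(((Lc ^ m : ℕ) : ℝ) ^ 12 / 4)) 0).S ν₀ z₀) (diagK fun z b => -(∑ α : Fin (3 + 1), ∑ x ∈ blockSitesF (Lc ^ m) (blk (Lc ^ m) (legSite (ctr 4 (Lc ^ m)) z b)), colH (coDressKBmAt (ctr 4 (Lc ^ m)) (Lc ^ m) (KInvStep (d := 3) (Lc ^ m) 0)) (Lc ^ m) μ₀ 0 α x * ((((Lc ^ m : ℕ) : ℝ) ^ 4 / 2) * faceWt (ctrOff 4 (Lc ^ m)) (Lc ^ m) α x))))))))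
    -- (dd) `½·tadpole G₀ ([Λc ν₀ z₀, [Λc μ₀ 0, Dsh n]])` (letter: leaf-01's `ColumnGaugeDefectRecord.vertexFamily₂_commComm_record`, v1.2), at the scale `n := Lc^m`
    (hWdd : ∀ (m : ℕ) (μ₀ ν₀ : Fin 4) (z₀ : Site 4), Wdd m μ₀ ν₀ z₀
      = (1 / 2) * tadpole (coDressKBmAt (ctr 4 (Lc ^ m)) (Lc ^ m) (KInvStep (d := 3) (Lc ^ m) 0)) (comp (diagK fun z' b => ((Lc ^ m : ℕ) : ℝ) ^ 4 / 2 * bmGaugeAt (ctr 4 (Lc ^ m)) (colH (KInvStep (d := 3) (Lc ^ m) 0) (Lc ^ m) ν₀ z₀) (Lc ^ m) (legSite (ctr 4 (Lc ^ m)) z' b))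
                (comp (diagK fun z' b => ((Lc ^ m : ℕ) : ℝ) ^ 4 / 2 * bmGaugeAt (ctr 4 (Lc ^ m)) (colH (KInvStep (d := 3) (Lc ^ m) 0) (Lc ^ m) μ₀ 0) (Lc ^ m) (legSite (ctr 4 (Lc ^ m)) z' b)) (Dsh (Lc ^ m))
              - comp (Dsh (Lc ^ m)) (diagK fun z' b => ((Lc ^ m : ℕ) : ℝ) ^ 4 / 2 * bmGaugeAt (ctr 4 (Lc ^ m)) (colH (KInvStep (d := 3) (Lc ^ m) 0) (Lc ^ m) μ₀ 0) (Lc ^ m) (legSite (ctr 4 (Lc ^ m)) z' b)))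
              - comp (comp (diagK fun z' b => ((Lc ^ m : ℕ) : ℝ) ^ 4 / 2 * bmGaugeAt (ctr 4 (Lc ^ m)) (colH (KInvStep (d := 3) (Lc ^ m) 0) (Lc ^ m) μ₀ 0) (Lc ^ m) (legSite (ctr 4 (Lc ^ m)) z' b)) (Dsh (Lc ^ m))
              - comp (Dsh (Lc ^ m)) (diagK fun z' b => ((Lc ^ m : ℕ) : ℝ) ^ 4 / 2 * bmGaugeAt (ctr 4 (Lc ^ m)) (colH (KInvStep (d := 3) (Lc ^ m) 0) (Lc ^ m) μ₀ 0) (Lc ^ m) (legSite (ctr 4 (Lc ^ m)) z' b)))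
                (diagK fun z' b => ((Lc ^ m : ℕ) : ℝ) ^ 4 / 2 * bmGaugeAt (ctr 4 (Lc ^ m)) (colH (KInvStep (d := 3) (Lc ^ m) 0) (Lc ^ m) ν₀ z₀) (Lc ^ m) (legSite (ctr 4 (Lc ^ m)) z' b))))
    -- (xb) the two `G^{Dsh}` CROSS BUBBLES `½·(bubble G₀ (V^s μ₀ 0) (G^{Dsh} ν₀ z₀) + bubble G₀ (G^{Dsh} μ₀ 0) (V^s ν₀ z₀))` (letters: `vertexFamily_GDsh_record`, gan24-leaf-05's `vertexFamily_vertexOfK_K₀_S_zero_record`, lit `abs_bubble_le`), at the scale `n := Lc^m`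
    (hWxb : ∀ (m : ℕ) (μ₀ ν₀ : Fin 4) (z₀ : Site 4), Wxb m μ₀ ν₀ z₀
      = (1 / 2) * (bubble (coDressKBmAt (ctr 4 (Lc ^ m)) (Lc ^ m) (KInvStep (d := 3) (Lc ^ m) 0)) (vertexOfK (KInvStep (d := 3) (Lc ^ m) 0) (Lc ^ m) (JsB12CombSh0 (Lc := Lc ^ m) hLc.pow N (symTablesAn1S2 3 (Lc ^ m) (cΛ m)) (cΛ m) (-(((Lc ^ m : ℕ) : ℝ) ^ 12 / 4)) 0).S μ₀ 0) (comp (diagK fun z' b => ((Lc ^ m : ℕ) : ℝ) ^ 4 / 2 * bmGaugeAt (ctr 4 (Lc ^ m)) (colH (KInvStep (d := 3) (Lc ^ m) 0) (Lc ^ m) ν₀ z₀) (Lc ^ m) (legSite (ctr 4 (Lc ^ m)) z' b)) (Dsh (Lc ^ m))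
              - comp (Dsh (Lc ^ m)) (diagK fun z' b => ((Lc ^ m : ℕ) : ℝ) ^ 4 / 2 * bmGaugeAt (ctr 4 (Lc ^ m)) (colH (KInvStep (d := 3) (Lc ^ m) 0) (Lc ^ m) ν₀ z₀) (Lc ^ m) (legSite (ctr 4 (Lc ^ m)) z' b)))
            + bubble (coDressKBmAt (ctr 4 (Lc ^ m)) (Lc ^ m) (KInvStep (d := 3) (Lc ^ m) 0)) (comp (diagK fun z' b => ((Lc ^ m : ℕ) : ℝ) ^ 4 / 2 * bmGaugeAt (ctr 4 (Lc ^ m)) (colH (KInvStep (d := 3) (Lc ^ m) 0) (Lc ^ m) μ₀ 0) (Lc ^ m) (legSite (ctr 4 (Lc ^ m)) z' b)) (Dsh (Lc ^ m))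
              - comp (Dsh (Lc ^ m)) (diagK fun z' b => ((Lc ^ m : ℕ) : ℝ) ^ 4 / 2 * bmGaugeAt (ctr 4 (Lc ^ m)) (colH (KInvStep (d := 3) (Lc ^ m) 0) (Lc ^ m) μ₀ 0) (Lc ^ m) (legSite (ctr 4 (Lc ^ m)) z' b))) (vertexOfK (KInvStep (d := 3) (Lc ^ m) 0) (Lc ^ m) (JsB12CombSh0 (Lc := Lc ^ m) hLc.pow N (symTablesAn1S2 3 (Lc ^ m) (cΛ m)) (cΛ m) (-(((Lc ^ m : ℕ) : ℝ) ^ 12 / 4)) 0).S ν₀ z₀)))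
    -- (bb) the `G^{Dsh}`–`G^{Dsh}` BUBBLE `½·bubble G₀ (G^{Dsh} μ₀ 0) (G^{Dsh} ν₀ z₀)`, at the scale `n := Lc^m`
    (hWbb : ∀ (m : ℕ) (μ₀ ν₀ : Fin 4) (z₀ : Site 4), Wbb m μ₀ ν₀ z₀
      = (1 / 2) * bubble (coDressKBmAt (ctr 4 (Lc ^ m)) (Lc ^ m) (KInvStep (d := 3) (Lc ^ m) 0)) (comp (diagK fun z' b => ((Lc ^ m : ℕ) : ℝ) ^ 4 / 2 * bmGaugeAt (ctr 4 (Lc ^ m)) (colH (KInvStep (d := 3) (Lc ^ m) 0) (Lc ^ m) μ₀ 0) (Lc ^ m) (legSite (ctr 4 (Lc ^ m)) z' b)) (Dsh (Lc ^ m))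
              - comp (Dsh (Lc ^ m)) (diagK fun z' b => ((Lc ^ m : ℕ) : ℝ) ^ 4 / 2 * bmGaugeAt (ctr 4 (Lc ^ m)) (colH (KInvStep (d := 3) (Lc ^ m) 0) (Lc ^ m) μ₀ 0) (Lc ^ m) (legSite (ctr 4 (Lc ^ m)) z' b))) (comp (diagK fun z' b => ((Lc ^ m : ℕ) : ℝ) ^ 4 / 2 * bmGaugeAt (ctr 4 (Lc ^ m)) (colH (KInvStep (d := 3) (Lc ^ m) 0) (Lc ^ m) ν₀ z₀) (Lc ^ m) (legSite (ctr 4 (Lc ^ m)) z' b)) (Dsh (Lc ^ m))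
              - comp (Dsh (Lc ^ m)) (diagK fun z' b => ((Lc ^ m : ℕ) : ℝ) ^ 4 / 2 * bmGaugeAt (ctr 4 (Lc ^ m)) (colH (KInvStep (d := 3) (Lc ^ m) 0) (Lc ^ m) ν₀ z₀) (Lc ^ m) (legSite (ctr 4 (Lc ^ m)) z' b))))
    -- the m-INDEPENDENT prices (constants bound BEFORE `∀ m`)
    {Cins Crest Cmcol Cms Clamf Cdd Cxb Cbb : ℝ}
    (hAins : ∀ m a e, AbsMoment₂ (Wins m a e)) (hBins : ∀ m, |secondMoment (Wins m) μ ν| ≤ Cins)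
    (hArest : ∀ m a e, AbsMoment₂ (Wrest m a e)) (hBrest : ∀ m, |secondMoment (Wrest m) μ ν| ≤ Crest)
    (hAmcol : ∀ m a e, AbsMoment₂ (Wmcol m a e)) (hBmcol : ∀ m, |secondMoment (Wmcol m) μ ν| ≤ Cmcol)
    (hAms : ∀ m a e, AbsMoment₂ (Wms m a e)) (hBms : ∀ m, |secondMoment (Wms m) μ ν| ≤ Cms)
    (hAlamf : ∀ m a e, AbsMoment₂ (Wlamf m a e)) (hBlamf : ∀ m, |secondMoment (Wlamf m) μ ν| ≤ Clamf)
    (hAdd : ∀ m a e, AbsMoment₂ (Wdd m a e)) (hBdd : ∀ m, |secondMoment (Wdd m) μ ν| ≤ Cdd)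
    (hAxb : ∀ m a e, AbsMoment₂ (Wxb m a e)) (hBxb : ∀ m, |secondMoment (Wxb m) μ ν| ≤ Cxb)
    (hAbb : ∀ m a e, AbsMoment₂ (Wbb m a e)) (hBbb : ∀ m, |secondMoment (Wbb m) μ ν| ≤ Cbb)
    (m : ℕ) :
    |secondMoment (fun (a e : Fin 4) (z : Site 4) =>
        TshotOf Lc (JcOfTabs hLc N (fun k => symTablesAn1S2 3 (Lc ^ k) (cΛ k)) cΛ (fun k => -(((Lc ^ k : ℕ) : ℝ) ^ 12 / 4))) m a e z
          - hessKer (coDressKBmAt (toSite (ctrOff 4 (Lc ^ m))) (Lc ^ m) (KInvStep (d := 3) (Lc ^ m) 0))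
              (vertexOfK (coDressKBmAt (toSite (ctrOff 4 (Lc ^ m))) (Lc ^ m) (KInvStep (d := 3) (Lc ^ m) 0)) (Lc ^ m) (JsB12CombSh0 (Lc := Lc ^ m) hLc.pow N (symTablesAn1S2 3 (Lc ^ m) (cΛ m)) (cΛ m) (-(((Lc ^ m : ℕ) : ℝ) ^ 12 / 4)) 0).S)
              (vertex2OfK (coDressKBmAt (toSite (ctrOff 4 (Lc ^ m))) (Lc ^ m) (KInvStep (d := 3) (Lc ^ m) 0)) (Lc ^ m)
                (fun κ u κ' u' => (((Lc ^ m : ℕ) : ℝ) ^ 8) • wilsonW₂ 3 ((8 * (N : ℝ) ^ 2)⁻¹ • wsym22 N) κ u κ' u' + (-(((Lc ^ m : ℕ) : ℝ) ^ 12 / 4)) • symVh₂SAn1 3 (Lc ^ m) κ u κ' u')) a e z) μ ν|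
      ≤ Cins + Crest + Cmcol + Cms + Clamf + Cdd + Cxb + Cbb := by
  have h := abs_secondMoment_chartDefect_le_of_rows (n := Lc ^ m) hLc.pow hτ ho hN c (cΛ m) μ ν
    (Wins m) (Wrest m) (Wmcol m) (Wms m) (Wlamf m) (Wdd m) (Wxb m) (Wbb m)
    (hWins m) (hWrest m) (hWmcol m) (hWms m) (hWlamf m) (hWdd m) (hWxb m) (hWbb m)
    (hAins m) (hBins m) (hArest m) (hBrest m) (hAmcol m) (hBmcol m) (hAms m) (hBms m) (hAlamf m) (hBlamf m) (hAdd m) (hBdd m) (hAxb m) (hBxb m) (hAbb m) (hBbb m)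
  rw [show TshotOf Lc (JcOfTabs hLc N (fun k => symTablesAn1S2 3 (Lc ^ k) (cΛ k)) cΛ (fun k => -(((Lc ^ k : ℕ) : ℝ) ^ 12 / 4))) m
      = TOf (N := Lc ^ m) (JcOfTabs hLc N (fun k => symTablesAn1S2 3 (Lc ^ k) (cΛ k)) cΛ (fun k => -(((Lc ^ k : ℕ) : ℝ) ^ 12 / 4)) m) from rfl,
    JcOfTabs_apply]
  exact h

end Summit.QuantumFields.BalabanUV.Beta.D1BFx.ChartDefectHeadScales

end
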